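import Summits.QuantumFields.BalabanUV.Beta.GAN24.CombExitFaceSlotStaircase
import Summits.QuantumFields.BalabanUV.Beta.GAN24.ExitFaceSlotStaircaseDeep

/-!
# `BalabanUV.Beta.GAN24.CombExitFaceSlotStaircaseDeep` — binder row G-an2-4 ∕ (CONV-C), TRANSFER-III, the (III′) (C)-row's `hXF (l+1)` FACE TERMS (OWNER gan24-p1 g53's
# memo `M3-HXF-SIZING-g53.md` §1, the «deep face value» lane): **THE PERIOD-`N` EXIT-FACE-GATED SLOT SUM AND THE `(N, N′)` TWO-FACE CURRENTS OF THE COMB CUBIC SECTOR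
# `V^c_j = e3OfK Lc G_j (𝒯 S̃comb_j)` IN CLOSED FORM — `E2_{j+1}`-IMAGES OF «PERIOD-`N` STAIRCASE × PERIOD-`N′` EXIT FACE»**, i.e. leaf-06 g54's `ExitFaceSlotStaircaseDeep` §1–§2
# with the spine member `SrecAt … j` replaced by the transported comb member (an1's record `symTablesAn1S2 d Lc cΛt`, comb root `toSite (ctrOff (d+1) Lc)`, the Ward pins
# `cE = Lc^{d+1}`, `cVH = −Lc^{d+1}·½·Lc^{d+1}`; every `d j cΛt cΛ`, EVERY `N, N′ ≥ 1`).  My T1 `CombExitFaceSlotStaircase` (g87) is the case `N = N′ = Lc`; the deep face reads of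
# `hXF (l+1)` need `N = N′ = Lc·P m`.
# (G-an2-4 CRUX TEAM (2), leaf prover `b2b-balaban-gan24-formalise-leaf-01`, gen 88; journal [LEAF01-G88-INTENT-1])

NOT IN PRINT; OUR BOOKKEEPING ([folklore] BY NAME: my T1 §0 `CombExitFaceSlotStaircase.tsum_grad_mul_e3OfK_transport_ScombOf_inl_inl'` (R's comb L1′, root `toSite (ctrOff …)`) with the
period-`N` staircase `⌊t_ν∕N⌋`; leaf-06 g54's member-free `ExitFaceSlotStaircaseDeep.stairN_grad ∕ abs_stairN_le ∕ summable_E2_mul_linGrowth_faceN ∕ summable_linGrowth_faceN_mul_E2`; D1's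
`ValueHessianLinearGauge.tsum_E2_mul_exitFace_eq_zero' ∕ tsum_exitFace_mul_E2_eq_zero'`; 0 `def`, 0 cited fact, 0 `def … : Prop`, 0 sorry).
HONEST FRAMING (cell contract, verbatim): «discharging `BetaPertH` makes Bałaban's UV stability UNCONDITIONAL — a real constructive-QFT result; it is NOT the continuum limit and NOT the
Clay problem.»  HONEST DEPENDENCY (verbatim): «continuum YM on T⁴ ⇐ BetaPertH ∧ nine spine estimates (0/9 proved); BetaPertH ⇐ (D1) ∧ (D4) ∧ CAP+tail; G-an2-4 gates asym, D1 and NE2/3/4.»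

WHAT ([folklore]; `[NeZero Lc]`, every `d j cΛt cΛ`, `1 ≤ N`, `1 ≤ N′`): §1 **`faceSlot_e3OfK_eq_stairN`** (`Σ'_t [t_ν % N = N−1]·V^c_j ν t (x,z)_{ab} = ½·E2_{j+1}(x,z)_{ab}·(⌊z_ν∕N⌋ − ⌊x_ν∕N⌋)`);
§2 **`faceface_e3OfK_eq_stairN`** (right two-face current, open first leg) and **`faceface_e3OfK_eq_stairN_fst`** (left two-face current, open second leg) — the SAME right-hand sides as the
spine's, letter for letter.  Same names as leaf-06's, in the namespace `CombExitFaceSlotStaircaseDeep`.  Asserts NO value of Bałaban's tables beyond an1's ∕ an2's DEFINED ones; discharges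
NOTHING of `hXF (l+1)` by itself; NEVER «G-an2-4 closed» as (CONV-C); NOT D1, NOT `BetaPertH`, NOT continuum, NOT Clay.  2026-08-27; no existing file touched.
-/

noncomputable section

open Finset
open scoped BigOperators
open Literature.MathematicalPhysics.QuantumFieldTheory
open Literature.MathematicalPhysics.QuantumFieldTheory.Balaban1983to89
open Literature.MathematicalPhysics.QuantumFieldTheory.Balaban1983to89.Beta
open B12Sec2to5 (l1)
open ExpKernelCalculus (Site MKer comp)
open AffineAveraging (box toSite unitVec)
open AveragingContoursRooted (ctr ctrOff)
open OneStepResolventKernel (Fib)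
open OneStepKernelFamily (KInvStep)
open BalabanStepJetsSucc (E2)
open Summit.QuantumFields.BalabanUV.Beta.TameKernelCalculus (trK)
open Summit.QuantumFields.BalabanUV.Beta.AxialDressingRooted (coDressKBmAt)
open Summit.QuantumFields.BalabanUV.Beta.SpineRooted (e3OfK)
open Summit.QuantumFields.BalabanUV.Beta.SymSecondOrderTablesAn1 (symTablesAn1S2)
open Summit.QuantumFields.BalabanUV.Beta.CombChartStepJets (ScombOf)
open Summit.QuantumFields.BalabanUV.Beta.SymCorrectorKernel (psiKS)
open Summit.QuantumFields.BalabanUV.Beta.SymCorrectorFace (slotPsiS)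
open Summit.QuantumFields.BalabanUV.Beta.GAN24.ValueHessianLinearGauge (tsum_E2_mul_exitFace_eq_zero' tsum_exitFace_mul_E2_eq_zero')
open Summit.QuantumFields.BalabanUV.Beta.GAN24.ExitFaceSlotStaircaseDeep (stairN_grad abs_stairN_le summable_E2_mul_linGrowth_faceN summable_linGrowth_faceN_mul_E2)
open Summit.QuantumFields.BalabanUV.Beta.GAN24.CombExitFaceSlotStaircase (tsum_grad_mul_e3OfK_transport_ScombOf_inl_inl')

namespace Summit.QuantumFields.BalabanUV.Beta.GAN24.CombExitFaceSlotStaircaseDeep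

variable {d : ℕ} {Lc : ℕ} [NeZero Lc]

/-! ## §1 The period-`N` face-gated slot sum of the comb cubic sector -/

/-- [folklore] **THE PERIOD-`N` EXIT-FACE-GATED SLOT SUM OF THE COMB CUBIC SECTOR, IN CLOSED FORM** (every `d j cΛt cΛ`, ANY `N ≥ 1`):
`Σ'_t [t_ν % N = N−1]·V^c_j ν t (x,z)_{inl a, inl b} = ½·E2 d Lc (j+1) (x,z)_{ab}·(⌊z_ν∕N⌋ − ⌊x_ν∕N⌋)` — R's comb L1′ with the period-`N` staircase `g(t) = ⌊t_ν∕N⌋` (its gradient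
is the period-`N` exit-face slot, leaf-06's `stairN_grad`). -/
theorem faceSlot_e3OfK_eq_stairN (cΛt cΛ : ℝ) (j : ℕ) {N : ℕ} (hN : 1 ≤ N) (ν : Fin (d + 1)) (x z : Fin (d + 1) → ℤ) (a b : Fin (d + 1)) :
    (∑' t : Fin (d + 1) → ℤ, (if t ν % (N : ℤ) = (N : ℤ) - 1 then
        e3OfK Lc (coDressKBmAt (toSite (ctrOff (d + 1) Lc)) Lc (KInvStep (d := d) Lc j))
          (fun κ u => comp (comp (trK (psiKS (ctrOff (d + 1) Lc) Lc)) (slotPsiS (ctrOff (d + 1) Lc) Lc (ScombOf (symTablesAn1S2 d Lc cΛt) ((Lc : ℝ) ^ (d + 1)) (-((Lc : ℝ) ^ (d + 1) * (1 / 2) * (Lc : ℝ) ^ (d + 1))) cΛ j) κ u)) (psiKS (ctrOff (d + 1) Lc) Lc)) ν t x z (Sum.inl a) (Sum.inl b) else 0)) =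
      (1 / 2 : ℝ) * E2 d Lc (j + 1) x z (Sum.inl a) (Sum.inl b) * ((((z ν / (N : ℤ) : ℤ) : ℝ)) - (((x ν / (N : ℤ) : ℤ) : ℝ))) := by
  have key := tsum_grad_mul_e3OfK_transport_ScombOf_inl_inl' (d := d) (Lc := Lc) cΛt cΛ j (g := fun t : Fin (d + 1) → ℤ => (((t ν / (N : ℤ) : ℤ) : ℝ))) (abs_stairN_le N ν) x z a b
  rw [← key]
  refine tsum_congr fun t => ?_
  rw [Finset.sum_eq_single ν (fun κ _ hκ => by rw [stairN_grad hN ν κ t, if_neg hκ, zero_mul]) (fun h => absurd (Finset.mem_univ ν) h),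
    stairN_grad hN ν ν t, if_pos rfl]
  split_ifs
  · rw [one_mul]
  · rw [zero_mul]

/-! ## §2 The two-face currents of the comb cubic sector with independent slot and leg periods -/

/-- [folklore] **THE RIGHT TWO-FACE CURRENT OF THE COMB CUBIC SECTOR IN CLOSED FORM, PERIODS `(N, N′)`** (open first leg `(b, z)`, period-`N′` exit-face weight on the second leg,
period-`N` face gate on the slot): `Σ'_{s′} [s′_β % N′ = N′−1]·Σ'_t [t_ν % N = N−1]·V^c_j ν t (z,s′)_{inl b, inl β} = ½·Σ'_{s′} E2 d Lc (j+1) (z,s′)_{bβ}·(⌊s′_ν∕N⌋·[s′_β % N′ = N′−1])` —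
§1 pointwise in `s′`; the `⌊z_ν∕N⌋`-half dies by D1 at period `N′`.  The spine's `ExitFaceSlotStaircaseDeep.faceface_e3OfK_eq_stairN` has THE SAME right-hand side. -/
theorem faceface_e3OfK_eq_stairN (cΛt cΛ : ℝ) (j : ℕ) {N N' : ℕ} (hN : 1 ≤ N) (hN' : 1 ≤ N') (ν β : Fin (d + 1)) (z : Fin (d + 1) → ℤ) (b : Fin (d + 1)) :
    (∑' s' : Fin (d + 1) → ℤ, (if s' β % (N' : ℤ) = (N' : ℤ) - 1 then (1 : ℝ) else 0) *
        ∑' t : Fin (d + 1) → ℤ, (if t ν % (N : ℤ) = (N : ℤ) - 1 then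
          e3OfK Lc (coDressKBmAt (toSite (ctrOff (d + 1) Lc)) Lc (KInvStep (d := d) Lc j))
            (fun κ u => comp (comp (trK (psiKS (ctrOff (d + 1) Lc) Lc)) (slotPsiS (ctrOff (d + 1) Lc) Lc (ScombOf (symTablesAn1S2 d Lc cΛt) ((Lc : ℝ) ^ (d + 1)) (-((Lc : ℝ) ^ (d + 1) * (1 / 2) * (Lc : ℝ) ^ (d + 1))) cΛ j) κ u)) (psiKS (ctrOff (d + 1) Lc) Lc)) ν t z s' (Sum.inl b) (Sum.inl β) else 0)) =
      (1 / 2 : ℝ) * ∑' s' : Fin (d + 1) → ℤ, E2 d Lc (j + 1) z s' (Sum.inl b) (Sum.inl β) *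
        ((((s' ν / (N : ℤ) : ℤ) : ℝ)) * (if s' β % (N' : ℤ) = (N' : ℤ) - 1 then (1 : ℝ) else 0)) := by
  have hpt : ∀ s' : Fin (d + 1) → ℤ, (if s' β % (N' : ℤ) = (N' : ℤ) - 1 then (1 : ℝ) else 0) *
      (∑' t : Fin (d + 1) → ℤ, (if t ν % (N : ℤ) = (N : ℤ) - 1 then
        e3OfK Lc (coDressKBmAt (toSite (ctrOff (d + 1) Lc)) Lc (KInvStep (d := d) Lc j))
          (fun κ u => comp (comp (trK (psiKS (ctrOff (d + 1) Lc) Lc)) (slotPsiS (ctrOff (d + 1) Lc) Lc (ScombOf (symTablesAn1S2 d Lc cΛt) ((Lc : ℝ) ^ (d + 1)) (-((Lc : ℝ) ^ (d + 1) * (1 / 2) * (Lc : ℝ) ^ (d + 1))) cΛ j) κ u)) (psiKS (ctrOff (d + 1) Lc) Lc)) ν t z s' (Sum.inl b) (Sum.inl β) else 0)) =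
      (1 / 2 : ℝ) * (E2 d Lc (j + 1) z s' (Sum.inl b) (Sum.inl β) * ((((s' ν / (N : ℤ) : ℤ) : ℝ)) * (if s' β % (N' : ℤ) = (N' : ℤ) - 1 then (1 : ℝ) else 0)))
        - (1 / 2 : ℝ) * (E2 d Lc (j + 1) z s' (Sum.inl b) (Sum.inl β) * (if s' β % (N' : ℤ) = (N' : ℤ) - 1 then (((z ν / (N : ℤ) : ℤ) : ℝ)) else 0)) := by
    intro s'
    rw [faceSlot_e3OfK_eq_stairN cΛt cΛ j hN ν z s' b β]
    split_ifs <;> ring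
  have h1 := summable_E2_mul_linGrowth_faceN (d := d) (Lc := Lc) j (lam := fun s : Fin (d + 1) → ℤ => (((s ν / (N : ℤ) : ℤ) : ℝ))) (abs_stairN_le N ν) N' z b β
  have h2 : Summable fun s' : Fin (d + 1) → ℤ =>
      E2 d Lc (j + 1) z s' (Sum.inl b) (Sum.inl β) * (if s' β % (N' : ℤ) = (N' : ℤ) - 1 then (((z ν / (N : ℤ) : ℤ) : ℝ)) else 0) := by
    have h := summable_E2_mul_linGrowth_faceN (d := d) (Lc := Lc) j (lam := fun _ : Fin (d + 1) → ℤ => (((z ν / (N : ℤ) : ℤ) : ℝ)))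
      (A := |(((z ν / (N : ℤ) : ℤ) : ℝ))|) (B := 0) (fun _ => by rw [zero_mul, add_zero]) N' z b β
    refine h.congr fun s' => ?_
    split_ifs <;> simp
  rw [tsum_congr hpt, (h1.mul_left (1 / 2 : ℝ)).tsum_sub (h2.mul_left (1 / 2 : ℝ)), tsum_mul_left, tsum_mul_left,
    tsum_E2_mul_exitFace_eq_zero' (Lc := Lc) (j + 1) hN' b β z ((((z ν / (N : ℤ) : ℤ) : ℝ))), mul_zero, sub_zero]

/-- [folklore] **THE LEFT TWO-FACE CURRENT OF THE COMB CUBIC SECTOR IN CLOSED FORM, PERIODS `(N, N′)`** (period-`N′` exit-face weight on the first leg, open second leg `(a, x)`,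
period-`N` face gate on the slot in direction `μ`): `Σ'_y [y_α % N′ = N′−1]·Σ'_t [t_μ % N = N−1]·V^c_j μ t (y,x)_{inl α, inl a} = −½·Σ'_y (⌊y_μ∕N⌋·[y_α % N′ = N′−1])·E2 d Lc (j+1) (y,x)_{αa}`.
The spine's `ExitFaceSlotStaircaseDeep.faceface_e3OfK_eq_stairN_fst` has THE SAME right-hand side. -/
theorem faceface_e3OfK_eq_stairN_fst (cΛt cΛ : ℝ) (j : ℕ) {N N' : ℕ} (hN : 1 ≤ N) (hN' : 1 ≤ N') (μ α : Fin (d + 1)) (x : Fin (d + 1) → ℤ) (a : Fin (d + 1)) :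
    (∑' y : Fin (d + 1) → ℤ, (if y α % (N' : ℤ) = (N' : ℤ) - 1 then (1 : ℝ) else 0) *
        ∑' t : Fin (d + 1) → ℤ, (if t μ % (N : ℤ) = (N : ℤ) - 1 then
          e3OfK Lc (coDressKBmAt (toSite (ctrOff (d + 1) Lc)) Lc (KInvStep (d := d) Lc j))
            (fun κ u => comp (comp (trK (psiKS (ctrOff (d + 1) Lc) Lc)) (slotPsiS (ctrOff (d + 1) Lc) Lc (ScombOf (symTablesAn1S2 d Lc cΛt) ((Lc : ℝ) ^ (d + 1)) (-((Lc : ℝ) ^ (d + 1) * (1 / 2) * (Lc : ℝ) ^ (d + 1))) cΛ j) κ u)) (psiKS (ctrOff (d + 1) Lc) Lc)) μ t y x (Sum.inl α) (Sum.inl a) else 0)) =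
      -(1 / 2 : ℝ) * ∑' y : Fin (d + 1) → ℤ, ((((y μ / (N : ℤ) : ℤ) : ℝ)) * (if y α % (N' : ℤ) = (N' : ℤ) - 1 then (1 : ℝ) else 0)) *
        E2 d Lc (j + 1) y x (Sum.inl α) (Sum.inl a) := by
  have hpt : ∀ y : Fin (d + 1) → ℤ, (if y α % (N' : ℤ) = (N' : ℤ) - 1 then (1 : ℝ) else 0) *
      (∑' t : Fin (d + 1) → ℤ, (if t μ % (N : ℤ) = (N : ℤ) - 1 then
        e3OfK Lc (coDressKBmAt (toSite (ctrOff (d + 1) Lc)) Lc (KInvStep (d := d) Lc j))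
          (fun κ u => comp (comp (trK (psiKS (ctrOff (d + 1) Lc) Lc)) (slotPsiS (ctrOff (d + 1) Lc) Lc (ScombOf (symTablesAn1S2 d Lc cΛt) ((Lc : ℝ) ^ (d + 1)) (-((Lc : ℝ) ^ (d + 1) * (1 / 2) * (Lc : ℝ) ^ (d + 1))) cΛ j) κ u)) (psiKS (ctrOff (d + 1) Lc) Lc)) μ t y x (Sum.inl α) (Sum.inl a) else 0)) =
      (1 / 2 : ℝ) * ((if y α % (N' : ℤ) = (N' : ℤ) - 1 then (((x μ / (N : ℤ) : ℤ) : ℝ)) else 0) * E2 d Lc (j + 1) y x (Sum.inl α) (Sum.inl a))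
        - (1 / 2 : ℝ) * (((((y μ / (N : ℤ) : ℤ) : ℝ)) * (if y α % (N' : ℤ) = (N' : ℤ) - 1 then (1 : ℝ) else 0)) * E2 d Lc (j + 1) y x (Sum.inl α) (Sum.inl a)) := by
    intro y
    rw [faceSlot_e3OfK_eq_stairN cΛt cΛ j hN μ y x α a]
    split_ifs <;> ring
  have h2 := summable_linGrowth_faceN_mul_E2 (d := d) (Lc := Lc) j (lam := fun y : Fin (d + 1) → ℤ => (((y μ / (N : ℤ) : ℤ) : ℝ))) (abs_stairN_le N μ) N' x α a
  have h1 : Summable fun y : Fin (d + 1) → ℤ =>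
      (if y α % (N' : ℤ) = (N' : ℤ) - 1 then (((x μ / (N : ℤ) : ℤ) : ℝ)) else 0) * E2 d Lc (j + 1) y x (Sum.inl α) (Sum.inl a) := by
    have h := summable_linGrowth_faceN_mul_E2 (d := d) (Lc := Lc) j (lam := fun _ : Fin (d + 1) → ℤ => (((x μ / (N : ℤ) : ℤ) : ℝ)))
      (A := |(((x μ / (N : ℤ) : ℤ) : ℝ))|) (B := 0) (fun _ => by rw [zero_mul, add_zero]) N' x α a
    refine h.congr fun y => ?_
    split_ifs <;> simp
  rw [tsum_congr hpt, (h1.mul_left (1 / 2 : ℝ)).tsum_sub (h2.mul_left (1 / 2 : ℝ)), tsum_mul_left, tsum_mul_left,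
    tsum_exitFace_mul_E2_eq_zero' (Lc := Lc) (j + 1) hN' a α x ((((x μ / (N : ℤ) : ℤ) : ℝ))), mul_zero, zero_sub, neg_mul]

end Summit.QuantumFields.BalabanUV.Beta.GAN24.CombExitFaceSlotStaircaseDeep

end
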